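import Summits.Ventures.PercRepro.LemmaBSlackTwo
import Summits.Ventures.PercRepro.NearDominantHolds
import Summits.Ventures.PercRepro.MSSplitCover

/-!
# Lemma B two pairs beyond a dominant column, unconditionally

`LemmaBSlackTwo.lean` reduced `crossCount ≤ columnCount i + 2 → crossCount ≤ topBotCount` to the
candidate `DiffBandCandidate` (`|F| + 2 ≤ |G|` for a sandwiched family). This file proves the
candidate for SPLIT families — which is all the reduction needs, since a column with three
crossing-pair types is the split `T_ij ⊔ T_ik` (no member of one class is comparable with a member
of the other: `x ≤ y` would give `c yᶜ ≤ c xᶜ`, two distinct crossing cells) — and states the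
unconditional corollaries (proofs/P4-gen9.md §10, Theorem 10.1 and Corollary 10.2).

* `card_add_two_le_of_split`: for a split family `F = s ⊔ t` of configurations sandwiched in a
  down-set `G` containing every singleton, `|F| + 2 ≤ |G|`. Proof: `|F \\ F| ≥ |F| + 1` since a
  tight family is connected (`msTightNoSplit`); if `|G| ≤ |F| + 1` then `G = F \\ F` has excess
  one, and the cover theorem `MSTight.cover_of_split_excess_one`, transported along the indicator
  map `toFinset`, gives members `A ∪ B = ⊤`, whence `Aᶜ ≤ B \ A ∈ G` — against `Aᶜ ∉ G`.
* `columnCount_add_two_le_topBotCount_of_threeTypes'`: `columnCount i + 2 ≤ topBotCount` for every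
  monotone map with three crossing-pair types;
* `crossCount_le_topBotCount_of_le_columnCount_add_two'`: **Lemma B** for every monotone
  `c : Config S → Setoid (Fin 4)` with `crossCount ≤ columnCount i + 2`.
-/

namespace PercRepro

open Finset
open scoped FinsetFamily

section Transfer

variable {S : Type} [Fintype S] [DecidableEq S]

/-- The indicator map commutes with joins. -/
theorem toFinset_sup (A B : Config S) : toFinset (A ⊔ B) = toFinset A ∪ toFinset B := by
  ext i
  simp only [mem_toFinset, Finset.mem_union, Pi.sup_apply]
  cases A i <;> cases B i <;> decide

omit [DecidableEq S] in
/-- The indicator finset of the full configuration. -/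
theorem toFinset_top : toFinset (⊤ : Config S) = Finset.univ := by
  ext i
  simp [mem_toFinset]

/-- The configuration of a finset (a section of the indicator map; p3's `ofFinset` under another
name, to avoid the duplicate). -/
def configOfFinset (W : Finset S) : Config S := fun i => decide (i ∈ W)

/-- `configOfFinset` is a section of the indicator map. -/
theorem toFinset_configOfFinset (W : Finset S) : toFinset (configOfFinset W) = W := by
  ext i
  simp [mem_toFinset, configOfFinset]

/-- The indicator finset of a singleton configuration. -/
theorem toFinset_singleConfig (e : S) : toFinset (singleConfig e) = {e} := by
  ext i
  simp [mem_toFinset, singleConfig]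

end Transfer

section SplitCandidate

variable {S : Type} [Fintype S] [DecidableEq S]

/-- **The candidate for split families.** A split family `F = s ⊔ t` of configurations (both
sides nonempty, no comparable pair across), sandwiched in a down-set `G` containing every
singleton — its differences lie in `G`, its members and their complements do not — has
`|F| + 2 ≤ |G|`. -/
theorem card_add_two_le_of_split (G F s t : Finset (Config S)) (hst : s ∪ t = F)
    (hdisj : Disjoint s t) (hs : s.Nonempty) (ht : t.Nonempty)
    (hcross : ∀ a ∈ s, ∀ b ∈ t, ¬ a ≤ b ∧ ¬ b ≤ a)
    (hG : ∀ W ∈ G, ∀ W' ≤ W, W' ∈ G) (hsing : ∀ e : S, singleConfig e ∈ G)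
    (hdiff : ∀ A ∈ F, ∀ B ∈ F, A \ B ∈ G) (hFG : ∀ A ∈ F, A ∉ G) (hcompl : ∀ A ∈ F, Aᶜ ∉ G) :
    F.card + 2 ≤ G.card := by
  have hDG : F \\ F ⊆ G := by
    intro W hW
    obtain ⟨A, hA, B, hB, rfl⟩ := Finset.mem_diffs.1 hW
    exact hdiff A hA B hB
  -- a split family is not tight: `|F \\ F| ≥ |F| + 1`
  have hMS : F.card ≤ (F \\ F).card := Finset.card_le_card_diffs F
  have hnt : (F \\ F).card ≠ F.card := by
    intro htight
    obtain ⟨a, ha, b, hb, hab⟩ := msTightNoSplit s t hs ht hdisj (by rw [hst]; exact htight)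
    rcases hab with h | h
    · exact (hcross a ha b hb).1 h
    · exact (hcross a ha b hb).2 h
  by_contra hlt
  have hGcard : G.card = F.card + 1 := by
    have := Finset.card_le_card hDG
    omega
  have hDeq : F \\ F = G := Finset.eq_of_subset_of_card_le hDG (by omega)
  -- transport to finsets
  set F' := F.image toFinset with hF'
  have hF'diffs : F' \\ F' = G.image toFinset := by
    rw [hF', ← image_toFinset_diffs, hDeq]
  have hcov : MSTight.CoverHyp (Finset.univ : Finset S) F' (s.image toFinset)
      (t.image toFinset) := by
    refine ⟨fun _ _ => Finset.subset_univ _, ⟨?_, ?_, hs.image _, ht.image _, ?_⟩, ?_, ?_, ?_, ?_⟩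
    · rw [← Finset.image_union, hst]
    · exact (Finset.disjoint_image toFinset_injective).2 hdisj
    · intro a' ha' b' hb'
      obtain ⟨a, ha, rfl⟩ := Finset.mem_image.1 ha'
      obtain ⟨b, hb, rfl⟩ := Finset.mem_image.1 hb'
      exact ⟨fun h => (hcross a ha b hb).1 (toFinset_subset_iff.1 h),
        fun h => (hcross a ha b hb).2 (toFinset_subset_iff.1 h)⟩
    · -- down-closed
      intro W hW W' hW'
      rw [hF'diffs] at hW ⊢
      obtain ⟨A, hA, rfl⟩ := Finset.mem_image.1 hW
      refine Finset.mem_image.2 ⟨configOfFinset W', hG A hA _ ?_, toFinset_configOfFinset W'⟩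
      exact toFinset_subset_iff.1 (by rw [toFinset_configOfFinset]; exact hW')
    · -- singletons
      intro r _
      rw [hF'diffs]
      exact Finset.mem_image.2 ⟨singleConfig r, hsing r, toFinset_singleConfig r⟩
    · -- no member is a difference
      intro A' hA' hA'D
      rw [hF'diffs] at hA'D
      obtain ⟨A, hA, rfl⟩ := Finset.mem_image.1 hA'
      obtain ⟨B, hB, hBA⟩ := Finset.mem_image.1 hA'D
      rw [toFinset_injective hBA] at hB
      exact hFG A hA hB
    · -- excess one
      rw [hF'diffs, Finset.card_image_of_injective _ toFinset_injective,
        Finset.card_image_of_injective _ toFinset_injective, hGcard]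
  obtain ⟨a', ha', b', hb', hab⟩ := MSTight.cover_of_split_excess_one hcov
  obtain ⟨A, hA, rfl⟩ := Finset.mem_image.1 ha'
  obtain ⟨B, hB, rfl⟩ := Finset.mem_image.1 hb'
  have htop : A ⊔ B = ⊤ := toFinset_injective (by rw [toFinset_sup, toFinset_top]; exact hab)
  have hAc : Aᶜ ≤ B := by
    calc Aᶜ = Aᶜ ⊓ (A ⊔ B) := by rw [htop, inf_top_eq]
      _ = (Aᶜ ⊓ A) ⊔ (Aᶜ ⊓ B) := inf_sup_left _ _ _
      _ = Aᶜ ⊓ B := by rw [compl_inf_eq_bot, bot_sup_eq]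
      _ ≤ B := inf_le_right
  have hAB : Aᶜ ≤ B \ A := le_sdiff.2 ⟨hAc, disjoint_compl_left⟩
  exact hcompl A hA (hG _ (hdiff B hB A hA) _ hAB)

end SplitCandidate

section Reduction

variable {S : Type} [Fintype S] [DecidableEq S]

/-- Every index of `Fin 3` has two others. -/
theorem fin3_others (i : Fin 3) : ∃ j₁ j₂ : Fin 3, j₁ ≠ i ∧ j₂ ≠ i ∧ j₁ ≠ j₂ ∧
    ∀ j : Fin 3, j ≠ i → j = j₁ ∨ j = j₂ := by
  revert i; decide

/-- Two distinct crossing cells are incomparable. -/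
theorem cross4_not_le {j k : Fin 3} (hjk : j ≠ k) : ¬ cross4 j ≤ cross4 k := by
  intro h
  apply cross4_ne_bot j
  rw [← cross4_isCrossingFamily.inf_eq_bot hjk]
  exact (inf_eq_left.2 h).symm

open Classical in
/-- **`columnCount i + 2 ≤ topBotCount`** for every monotone map with three crossing-pair types:
the column is the split `T_ij ⊔ T_ik`, sandwiched in the `⊥`-members of good pairs. -/
theorem columnCount_add_two_le_topBotCount_of_threeTypes' (c : Config S → Setoid (Fin 4))
    (hc : Monotone c) (h3 : ThreeTypes c) (i : Fin 3) :
    columnCount cross4 c i + 2 ≤ topBotCount c := by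
  obtain ⟨j₁, j₂, hj₁, hj₂, hj₁₂, hall⟩ := fin3_others i
  rw [← card_botSet, columnCount]
  set s := (columnSet cross4 c i).filter fun A => c Aᶜ = cross4 j₁ with hs
  set t := (columnSet cross4 c i).filter fun A => c Aᶜ = cross4 j₂ with ht
  have hmem : ∀ A, A ∈ columnSet cross4 c i ↔ c A = cross4 i ∧ ∃ j : Fin 3, j ≠ i ∧
      c Aᶜ = cross4 j := by
    intro A
    simp only [columnSet, Finset.mem_filter, Finset.mem_univ, true_and]
  refine card_add_two_le_of_split (botSet c) (columnSet cross4 c i) s t ?_ ?_ ?_ ?_ ?_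
    (fun W hW W' hle => botSet_lowerSet hc hW hle) (singleConfig_mem_botSet c hc h3) ?_ ?_ ?_
  · -- `s ∪ t` is the column
    ext A
    rw [Finset.mem_union, hs, ht, Finset.mem_filter, Finset.mem_filter]
    constructor
    · rintro (⟨h, -⟩ | ⟨h, -⟩) <;> exact h
    · intro hA
      obtain ⟨-, j, hji, hj⟩ := (hmem A).1 hA
      rcases hall j hji with rfl | rfl
      · exact Or.inl ⟨hA, hj⟩
      · exact Or.inr ⟨hA, hj⟩
  · rw [Finset.disjoint_left]
    intro A hA1 hA2
    rw [hs, Finset.mem_filter] at hA1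
    rw [ht, Finset.mem_filter] at hA2
    exact hj₁₂ (cross4_injective (hA1.2.symm.trans hA2.2))
  · obtain ⟨ω, hω, hωc⟩ := h3 i j₁ (Ne.symm hj₁)
    exact ⟨ω, by rw [hs, Finset.mem_filter]; exact ⟨(hmem ω).2 ⟨hω, j₁, hj₁, hωc⟩, hωc⟩⟩
  · obtain ⟨ω, hω, hωc⟩ := h3 i j₂ (Ne.symm hj₂)
    exact ⟨ω, by rw [ht, Finset.mem_filter]; exact ⟨(hmem ω).2 ⟨hω, j₂, hj₂, hωc⟩, hωc⟩⟩
  · -- no comparable pair across: `a ≤ b` would give `c bᶜ ≤ c aᶜ`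
    intro a ha b hb
    rw [hs, Finset.mem_filter] at ha
    rw [ht, Finset.mem_filter] at hb
    constructor
    · intro hab
      have : c bᶜ ≤ c aᶜ := hc (compl_le_compl hab)
      rw [ha.2, hb.2] at this
      exact cross4_not_le (Ne.symm hj₁₂) this
    · intro hba
      have : c aᶜ ≤ c bᶜ := hc (compl_le_compl hba)
      rw [ha.2, hb.2] at this
      exact cross4_not_le hj₁₂ this
  · intro A hA B hB'
    rw [mem_botSet]
    have := compl_sdiff_mem_goodSet cross4 c cross4_isCrossingFamily hc hA hB'
    simp only [goodSet, Finset.mem_filter, Finset.mem_univ, true_and, compl_compl] at this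
    exact ⟨this.2, this.1⟩
  · intro A hA hG
    simp only [columnSet, Finset.mem_filter, Finset.mem_univ, true_and] at hA
    exact cross4_ne_bot i (hA.1 ▸ (mem_botSet.1 hG).1)
  · intro A hA hG
    simp only [columnSet, Finset.mem_filter, Finset.mem_univ, true_and] at hA
    obtain ⟨-, j, -, hj⟩ := hA
    exact cross4_ne_bot j (hj ▸ (mem_botSet.1 hG).1)

/-- **Lemma B two pairs beyond a dominant column, unconditionally**: for every monotone
`c : Config S → Setoid (Fin 4)`, `crossCount ≤ columnCount i + 2 → crossCount ≤ topBotCount`. -/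
theorem crossCount_le_topBotCount_of_le_columnCount_add_two' (c : Config S → Setoid (Fin 4))
    (hc : Monotone c) (i : Fin 3) (h : crossCount cross4 c ≤ columnCount cross4 c i + 2) :
    crossCount cross4 c ≤ topBotCount c := by
  by_cases h3 : ThreeTypes c
  · exact h.trans (columnCount_add_two_le_topBotCount_of_threeTypes' c hc h3 i)
  · obtain ⟨i', hi'⟩ := crossFam_eq_empty_of_not_threeTypes h3
    exact crossCount_le_topBotCount_of_column cross4 c cross4_isCrossingFamily hc i' hi'

end Reduction

end PercRepro
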